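import Summits.NavierStokesRegularity.FunctionalMining.TopEigStrainMixRateBound
import Summits.NavierStokesRegularity.FunctionalMining.NoGo.TopEigStrainMixRateGamma
import Summits.NavierStokesRegularity.FunctionalMining.NoGo.TopEigStrainMixRateGammaTwo
import HarnessLib

/-!
# FunctionalMining — K1-Q6 (a): the two ends of the rate window as NAMED nodes (dict work item D-K1Q6-2)

HONEST FRAMING. Search for candidate a priori estimates; no regularity claim. Nothing about
Navier–Stokes is asserted here: the two nodes are `@[conjecture] def`s (NAMED `Prop`s, OPEN in the
kernel), and the theorems are one-line bookkeeping about the exponent (monotonicity of the rate family,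
`1 ≤ γ` for `q ≥ 2`).

CONTEXT (`pub-nsfunc/DICTIONARY.md` §14 D-K6 / K1-Q6 (a); `pub-nsfunc/NOGO.md` v7.131 l.824 N14zzzh (3),
l.1043 D-K6 [v7.131 NOTE] = ERRATUM E-NO1; `pub-nsfunc/DISAGREE.md` OBJECTION D-O1, CLOSED — CONCEDED
2026-08-23). The dictionary number of escape (a) of door D-K6 is the infimum `a*` of the exponents `a`
for which `TopEigStrainMixRate q a` holds (`SpectralMixtureCandidates.lean`: the saturating law for the
mixture `F_ε = Φ_q + ε Z_q` with constant `C ε^{−a}` for all small `ε`; the admissible exponents form an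
up-set, `TopEigStrainMixRate.mono`). The records carry a WINDOW for `a*`, every end of which is a
statement of ONE fixed exponent, so no `sInf` is ever taken:

* lower end (on record, kernel): `0 < a` for every admissible `a`, GIVEN the (W2) kill of the `λ₁` row
  (`TopEigStrainMixRate.pos_of_not_saturatingLawSup`; the kill itself is the STAGED no-go door
  `TopEigSaturatingKill`, not a tree theorem);
* upper end ON RECORD, `a* ≤ γ := (3q − 3)/(2q − 3)`: the statement `TopEigStrainMixRateGamma q` below —
  CLAIMED by a ONE-PARTY pen argument of the dictionary seat (D-R2, `pub-nsfunc-dict/checks/g34/k1q6s/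
  K1Q6-S-CHECK-D.md` §(c): both productions of `F_ε` are bounded by the inviscid Hölder majorant of the
  `Z_q` row, split the viscosity as `ν′ = εν/(1+ε)`, compare budgets by `λ₁(S)² ≥ |S|²/6` on the trace-free
  cone), NOT re-derived by any second hand and NOT in the kernel — hence typed `@[conjecture]` here; the
  tag is dropped by whoever proves it;
* upper end CONJECTURAL, `a* ≤ 1`: the statement `TopEigStrainMixRateOne q` below — unstated and unproved
  in any file of record before this one (nogo E-NO1 (c): ‹s ≤ 1/γ› ⇔ ‹a* ≤ 1› CONJECTURAL; the no-go
  seat asked the dictionary to type it). Pushing the exponent from `γ` down to `1` would need the heat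
  price of `Φ_q` to absorb part of the production majorant — a partial heat-coercivity of the spectral
  core, which is exactly the open territory of door D-K6 ((W2): the full one fails).

Via the census-2 link (L8b) `TopEigStrainMixRate.gamma_mul_le` (`TopEigStrainMixRateBound.lean`, census-2
gen 41, filed by the prove seat gen 24 on 2026-08-23: on `𝕋³`, `γ · s ≤ a` for the heat-price exponent `s`
of any family of smooth divergence-free mean-zero data at a selected-production floor `c > 0` with budget
bound `B` and mixture heat price `≤ D ε^s` on `(0, ε₁]`) the two upper ends become CAPS ON `s`, typed here
as corollaries with the family hypothesis carried verbatim: `s ≤ 1` from the cap of record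
(`TopEigStrainMixRateGamma.heatExponent_le_one`) and `s ≤ 1/γ = (2q − 3)/(3q − 3)` from the conjectural
cap (`TopEigStrainMixRateOne.heatExponent_le_inv_gamma`). In the kernel BOTH caps are conditional on a
conjecture-tagged node (the pen argument D-R2 is not formalised). The exponent of record along the W18
family is `s = 0` (five hands, pen), so neither cap is contradicted by any computation on file.

PROVED here (bookkeeping only): `1 ≤ γ ≤ 3` for `q ≥ 2` (`one_le_topEigMixGamma`, `topEigMixGamma_le_three`),
hence `TopEigStrainMixRateOne q → TopEigStrainMixRateGamma q` (`TopEigStrainMixRateOne.rateGamma`),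
`TopEigStrainMixRateOne q → 1 ≤ a → TopEigStrainMixRate q a`, and the two caps on `s` above; nothing else.

FILING. Staged by the dictionary seat (gen 35) as `pub-nsfunc-dict/TopEigStrainMixRateOne.STAGING.lean`;
to be filed by the prove seat as `Summits/NavierStokesRegularity/FunctionalMining/TopEigStrainMixRateOne.lean`
(import cone: `TopEigStrainMixRateBound`, hence `SpectralMixtureCandidates`). STAGED until accepted; never
cited as fact.

[ours, bookkeeping; both nodes open]
FILING (prove seat g25, REQUEST #13, LEAD ORDER (γ) ‹drop the `@[conjecture]` of `TopEigStrainMixRateGamma q` or add the `_of_two_lt` link›): the dictionary seat's staged `TopEigStrainMixRateOne.STAGING.lean` 5412fd8fe160dccf with every declaration BODY byte-identical, plus (i) the imports of the no-go seat's tree files `NoGo/TopEigStrainMixRateGamma.lean` (K3, REQUEST #16: the γ node for real `q > 2`; credit shared census-2 C2-LKB-6 / dict D-R3 / nogo) and `NoGo/TopEigStrainMixRateGammaTwo.lean` (K4, REQUEST #18: `q = 2`; credit census-1 (cc.117) / census-2 (dd.184) / nogo), (ii) a closing section with the links `topEigStrainMixRateGamma_of_two_lt`, `topEigStrainMixRateGamma_two`,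 `topEigStrainMixRateGamma_of_two_le : 2 ≤ q → TopEigStrainMixRateGamma (d := Fin 3) q` and the unconditional cap `heatExponent_le_one_of_two_le`, and (iii) the `@[conjecture]` tag of `TopEigStrainMixRateGamma` DROPPED (the node is a theorem of the tree on its whole intended range `q ≥ 2`; its docstring below is the dictionary's text of record, written before K3/K4 — read 'CLAIMED … NOT in the kernel' as superseded by the closing section); `TopEigStrainMixRateOne q` (`a* ≤ 1`) keeps its tag: OPEN.
-/

noncomputable section

namespace Summit.NavierStokesRegularity.FunctionalMining

open MeasureTheory Literature.Analysis.FunctionSpaces Literature.Analysis.FluidPDE TopEig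

variable {d : Type*} [Fintype d] [DecidableEq d]

/-- **K1-Q6 (a), conjectural upper end of the rate window: `a* ≤ 1`**, i.e. the saturating law for the
mixture `F_ε = Φ_q + ε Z_q` at the K0 exponents holds with constant `C ε^{−1}` for all small `ε`:
`TopEigStrainMixRate q 1`. OPEN for every real `q ≥ 2`; no pen proof and no counterexample on record
(nogo ERRATUM E-NO1 (c), dict OBJECTION D-O1). [ours; open question] -/
@[conjecture] def TopEigStrainMixRateOne (q : ℝ) : Prop :=
  TopEigStrainMixRate (d := d) q 1

/-- **K1-Q6 (a), upper end of record: `a* ≤ γ = (3q − 3)/(2q − 3)`**, i.e. `TopEigStrainMixRate q γ`.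
CLAIMED by a one-party pen argument (dict D-R2: majorant form of the `Z_q` row + viscosity split
`ν′ = εν/(1+ε)`); NOT in the kernel, not re-derived by a second hand — typed as a conjecture node until a
proof lands. [ours; claimed on paper, open in the kernel] -/
def TopEigStrainMixRateGamma (q : ℝ) : Prop :=
  TopEigStrainMixRate (d := d) q ((3 * q - 3) / (2 * q - 3))

/-- Unfolding, for the record: the conjectural cap is literally the rate statement at exponent `1`.
[ours, bookkeeping] -/
theorem topEigStrainMixRateOne_iff (q : ℝ) :
    TopEigStrainMixRateOne (d := d) q ↔ TopEigStrainMixRate (d := d) q 1 := Iff.rfl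

/-- Unfolding, for the record: the cap of record is the rate statement at exponent `γ`.
[ours, bookkeeping] -/
theorem topEigStrainMixRateGamma_iff (q : ℝ) :
    TopEigStrainMixRateGamma (d := d) q ↔
      TopEigStrainMixRate (d := d) q ((3 * q - 3) / (2 * q - 3)) := Iff.rfl

/-- The conjectural cap hands the rate at every exponent `a ≥ 1` (up-set, `TopEigStrainMixRate.mono`).
[ours, bookkeeping] -/
theorem TopEigStrainMixRateOne.rate_of_one_le {q a : ℝ} (h : TopEigStrainMixRateOne (d := d) q)
    (ha : 1 ≤ a) : TopEigStrainMixRate (d := d) q a :=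
  TopEigStrainMixRate.mono h ha

/-- `1 ≤ γ = (3q − 3)/(2q − 3)` as soon as `q ≥ 2` (indeed for `q > 3/2`). [ours, bookkeeping] -/
theorem one_le_topEigMixGamma {q : ℝ} (hq : 2 ≤ q) : (1 : ℝ) ≤ (3 * q - 3) / (2 * q - 3) := by
  rw [le_div_iff₀ (by linarith)]
  linarith

/-- `γ ≤ 3` for `q ≥ 2`, with equality at `q = 2` (`γ(2) = 3`, `γ(3) = 2`, `γ(4) = 9/5`).
[ours, bookkeeping] -/
theorem topEigMixGamma_le_three {q : ℝ} (hq : 2 ≤ q) : (3 * q - 3) / (2 * q - 3) ≤ (3 : ℝ) := by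
  rw [div_le_iff₀ (by linarith)]
  linarith

/-- **The conjectural cap is the stronger one:** `a* ≤ 1` implies the cap of record `a* ≤ γ`
(for `q ≥ 2`, since `1 ≤ γ`). [ours, bookkeeping] -/
theorem TopEigStrainMixRateOne.rateGamma {q : ℝ} (hq : 2 ≤ q) (h : TopEigStrainMixRateOne (d := d) q) :
    TopEigStrainMixRateGamma (d := d) q :=
  h.rate_of_one_le (one_le_topEigMixGamma hq)

/-- Either cap hands the candidate LAW `TopEigStrainMixLaw q ε` at every small level `ε`
(`TopEigStrainMixRate.law_of_le`). [ours, bookkeeping] -/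
theorem TopEigStrainMixRateGamma.law_eventually {q : ℝ} (h : TopEigStrainMixRateGamma (d := d) q) :
    ∃ ε₀ : ℝ, 0 < ε₀ ∧ ∀ ε : ℝ, 0 < ε → ε ≤ ε₀ → TopEigStrainMixLaw (d := d) q ε :=
  TopEigStrainMixRate.law_of_le h

/-- **Cap of record on the heat-price exponent, `s ≤ 1`** (nogo E-NO1 (c)): along any family on `𝕋³` at a
selected-production floor with bounded budget whose mixture heat price is `≤ D ε^s` on `(0, ε₁]`, the cap
`a* ≤ γ` forces `s ≤ 1` — from (L8b) `γ · s ≤ γ` and `γ > 0`. Conditional on the conjecture-tagged node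
`TopEigStrainMixRateGamma`. [ours, bookkeeping] -/
theorem TopEigStrainMixRateGamma.heatExponent_le_one {q s c B D ε₁ : ℝ} (hq : 2 ≤ q)
    (h : TopEigStrainMixRateGamma (d := Fin 3) q) (hc : 0 < c) (hD : 0 < D) (hε₁ : 0 < ε₁)
    (hfam : ∀ ε : ℝ, 0 < ε → ε ≤ ε₁ →
      ∃ w : UnitAddTorus (Fin 3) → EuclideanSpace ℝ (Fin 3),
        Torus.IsSmooth w ∧ Torus.IsDivFree w ∧ Torus.HasZeroMean w ∧
        ∃ e : UnitAddTorus (Fin 3) → Fin 3 → ℝ, IsHeatMaxSelection w e ∧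
          Integrable (fun x => q * torusStrainTopEig w x ^ (q - 1) *
            quad (eulerStrainVec w x) (e x)) volume ∧
          c ≤ mixSelProduction q ε w e ∧
          2 * torusEnstrophy w * topEigStrainMix q ε w ^ (1 + (2 * q - 3)⁻¹) ≤ B ∧
          0 < mixHeat q ε w ∧ mixHeat q ε w ≤ D * ε ^ s) :
    s ≤ 1 := by
  have hγ : 0 < (3 * q - 3) / (2 * q - 3) := div_pos (by linarith) (by linarith)
  have h1 : (3 * q - 3) / (2 * q - 3) * s ≤ (3 * q - 3) / (2 * q - 3) :=
    TopEigStrainMixRate.gamma_mul_le hq h hc hD hε₁ hfam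
  exact le_of_mul_le_mul_left (by rw [mul_one]; exact h1) hγ

/-- **Conjectural cap on the heat-price exponent, `s ≤ 1/γ = (2q − 3)/(3q − 3)`** (nogo E-NO1 (c), dict
D-O1): the same family hypothesis and the conjectural cap `a* ≤ 1` force `s ≤ (2q − 3)/(3q − 3)`
(`= 1/3, 1/2, 5/9` at `q = 2, 3, 4`) — from (L8b) `γ · s ≤ 1`. Conditional on the conjecture-tagged node
`TopEigStrainMixRateOne`. [ours, bookkeeping] -/
theorem TopEigStrainMixRateOne.heatExponent_le_inv_gamma {q s c B D ε₁ : ℝ} (hq : 2 ≤ q)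
    (h : TopEigStrainMixRateOne (d := Fin 3) q) (hc : 0 < c) (hD : 0 < D) (hε₁ : 0 < ε₁)
    (hfam : ∀ ε : ℝ, 0 < ε → ε ≤ ε₁ →
      ∃ w : UnitAddTorus (Fin 3) → EuclideanSpace ℝ (Fin 3),
        Torus.IsSmooth w ∧ Torus.IsDivFree w ∧ Torus.HasZeroMean w ∧
        ∃ e : UnitAddTorus (Fin 3) → Fin 3 → ℝ, IsHeatMaxSelection w e ∧
          Integrable (fun x => q * torusStrainTopEig w x ^ (q - 1) *
            quad (eulerStrainVec w x) (e x)) volume ∧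
          c ≤ mixSelProduction q ε w e ∧
          2 * torusEnstrophy w * topEigStrainMix q ε w ^ (1 + (2 * q - 3)⁻¹) ≤ B ∧
          0 < mixHeat q ε w ∧ mixHeat q ε w ≤ D * ε ^ s) :
    s ≤ (2 * q - 3) / (3 * q - 3) := by
  have h2q : 0 < 2 * q - 3 := by linarith
  have h3q : 0 < 3 * q - 3 := by linarith
  have h1 : (3 * q - 3) / (2 * q - 3) * s ≤ 1 :=
    TopEigStrainMixRate.gamma_mul_le hq h hc hD hε₁ hfam
  rw [div_mul_eq_mul_div, div_le_one h2q] at h1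
  rw [le_div_iff₀ h3q]
  linarith

/-! ## Closing section (added at filing, prove seat g25): the γ node HOLDS for every real `q ≥ 2` -/

/-- **`TopEigStrainMixRateGamma q` holds in the kernel for every real `q > 2`:** the no-go seat's
`TopEig.topEigStrainMixRate_gamma_of_two_lt` (`NoGo/TopEigStrainMixRateGamma.lean`: the prove seat's
derivative step `TopEigStrainMixDeriv` with the lossy `Z_q ≤ ε⁻¹ F_ε` replaced by the coercivity
`Z_q ≤ 6^q Φ_q ≤ 6^q F_ε`; credit shared census-2 C2-LKB-6 / dict D-R3 / nogo K3), by `exact`. [ours] -/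
theorem topEigStrainMixRateGamma_of_two_lt {q : ℝ} (hq : 2 < q) :
    TopEigStrainMixRateGamma (d := Fin 3) q :=
  TopEig.topEigStrainMixRate_gamma_of_two_lt hq

/-- **`TopEigStrainMixRateGamma 2` holds in the kernel** (`γ(2) = (3·2−3)/(2·2−3) = 3`): the no-go
seat's `TopEig.topEigStrainMixRate_two_gamma : TopEigStrainMixRate 2 3`
(`NoGo/TopEigStrainMixRateGammaTwo.lean`, `ℰ = Z₂ ≤ 36 F_ε`; credit census-1 (cc.117) / census-2
(dd.184) / nogo K4). [ours] -/
theorem topEigStrainMixRateGamma_two : TopEigStrainMixRateGamma (d := Fin 3) 2 := by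
  have e : ((3 : ℝ) * 2 - 3) / (2 * 2 - 3) = 3 := by norm_num
  show TopEigStrainMixRate (d := Fin 3) 2 (((3 : ℝ) * 2 - 3) / (2 * 2 - 3))
  rw [e]
  exact TopEig.topEigStrainMixRate_two_gamma

/-- **`TopEigStrainMixRateGamma q` holds in the kernel for every real `q ≥ 2`** — the whole intended
range of K1-Q6 (a): the dictionary number of escape (a) satisfies `a*(q) ≤ γ(q) = (3q−3)/(2q−3)`
(`= 3, 2, 9/5` at `q = 2, 3, 4`). `TopEigStrainMixRateOne q` (`a* ≤ 1`) remains OPEN; nothing for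
`3/2 < q < 2`. [ours] -/
theorem topEigStrainMixRateGamma_of_two_le {q : ℝ} (hq : 2 ≤ q) :
    TopEigStrainMixRateGamma (d := Fin 3) q := by
  rcases hq.eq_or_lt with h | h
  · rw [← h]; exact topEigStrainMixRateGamma_two
  · exact topEigStrainMixRateGamma_of_two_lt h

/-- **Unconditional cap on the heat-price exponent for every real `q ≥ 2`: `s ≤ 1`** —
`TopEigStrainMixRateGamma.heatExponent_le_one` with its node discharged (for `q > 2` this is the
no-go seat's `TopEig.mixHeat_exponent_le_one`; at `q = 2` it is new). No power-law heat-price family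
at a selected-production floor with bounded budget can certify a rate exponent above `γ` through
(L8b). [ours] -/
theorem heatExponent_le_one_of_two_le {q s c B D ε₁ : ℝ} (hq : 2 ≤ q)
    (hc : 0 < c) (hD : 0 < D) (hε₁ : 0 < ε₁)
    (hfam : ∀ ε : ℝ, 0 < ε → ε ≤ ε₁ →
      ∃ w : UnitAddTorus (Fin 3) → EuclideanSpace ℝ (Fin 3),
        Torus.IsSmooth w ∧ Torus.IsDivFree w ∧ Torus.HasZeroMean w ∧
        ∃ e : UnitAddTorus (Fin 3) → Fin 3 → ℝ, IsHeatMaxSelection w e ∧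
          Integrable (fun x => q * torusStrainTopEig w x ^ (q - 1) *
            quad (eulerStrainVec w x) (e x)) volume ∧
          c ≤ mixSelProduction q ε w e ∧
          2 * torusEnstrophy w * topEigStrainMix q ε w ^ (1 + (2 * q - 3)⁻¹) ≤ B ∧
          0 < mixHeat q ε w ∧ mixHeat q ε w ≤ D * ε ^ s) :
    s ≤ 1 :=
  TopEigStrainMixRateGamma.heatExponent_le_one hq (topEigStrainMixRateGamma_of_two_le hq) hc hD hε₁ hfam

end Summit.NavierStokesRegularity.FunctionalMining
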